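import Summits.MatrixMultiplication.MatrixMultiplication.Theorems.SoloInformedConstantClass

/-!
# The general pin lemma and the rectangle theorem (every chart)

This work, §8.8 (T6)(d3) (gen 107). Setting of `SoloInformedTransfer` / `SoloInformedConstantClass`: twisted data
`a b c` over the odd part `G = S¹` with (E), a chart `Φ = (f, g, l)` into `G₀ = S⁰`, full separation
`Data.SepAll`, a class map `κ : G → R` (`κ x = κ y → SignEq x y`), rank `= |S⁰| · r`.

* `signEq_pair_of_adm_adm` — THE GENERAL PIN LEMMA (no 2-torsion): if `w₁ ≁ w₂` are both admissible against
  `(α, v)` and both against `(α', v')`, then `(v ~ v' ∧ α ~ α') ∨ (v ~ α' ∧ v' ~ α)`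
  (`{[α ± v]} = {[w₁], [w₂]} = {[α' ± v']}`; the case `α = α'` is `signEq_of_adm_adm`).
* `Data.pin_of_colConst`, `Data.b_agree_of_colConst`, `Data.colClass_of_ne` — consequences for two columns
  `j, j'` of `a` that are class-constant (classes `αc j`, `αc j'`) on a row set `I'`, at a `k` whose `c`-row is
  not class-constant on `I'`: rows `j, j'` of `b` agree at `k` as soon as `αc j ~ αc j'`, and two columns whose
  classes are both `≁ αc j₁` have equivalent classes (so the column classes form at most two cliques).
* `Data.sq_mul_min_le_of_rect` — THEOREM 8.15 (rectangle): if the columns `j ∈ J'` of `a` are class-constant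
  on a common row set `I'`, then `n² · min(|I'|, |J'|/2) ≤ 2 · (r · |S⁰|)` for EVERY chart
  (`K_c`-rows via `card_mul_le_of_c_rowsOn₂`, the other rows via the pin lemma and `card_mul_le_of_b_rowsOn₂`
  on the larger clique).
References: this work §8.8; CohnUmans2013 (arXiv:1207.6528) Def. 12.
-/

namespace Summit.MatrixMultiplication.MatrixMultiplication.Theorems.TwistedTPP

namespace FibreLines

variable {ι G : Type*} [AddCommGroup G]

/-- No 2-torsion: `x + x = y + y → x = y`. -/
theorem eq_of_two_eq (hG : ∀ x : G, x = -x → x = 0) {x y : G} (h : x + x = y + y) : x = y := by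
  have h1 : (x - y) + (x - y) = 0 := by
    have e : (x - y) + (x - y) = (x + x) - (y + y) := by abel
    rw [e, h, sub_self]
  have h2 : x - y = -(x - y) := eq_neg_of_add_eq_zero_left h1
  exact sub_eq_zero.mp (hG _ h2)

/-- `α + v ~ α' + v'` and `α - v ~ α' - v'` force `(v ~ v' ∧ α ~ α') ∨ (v ~ α' ∧ v' ~ α)` (no 2-torsion).
[this work, §8.8 (T6)] -/
theorem signEq_pair_of_signEq_add_sub (hG : ∀ x : G, x = -x → x = 0) {α α' v v' : G}
    (h₁ : SignEq (α + v) (α' + v')) (h₂ : SignEq (α - v) (α' - v')) :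
    (SignEq v v' ∧ SignEq α α') ∨ (SignEq v α' ∧ SignEq v' α) := by
  have es : (α + v) + (α - v) = α + α := by abel
  have ed : (α + v) - (α - v) = v + v := by abel
  rcases h₁ with e1 | e1 <;> rcases h₂ with e2 | e2
  · have hs : α + α = α' + α' := by
      have h0 : (α + v) + (α - v) = (α' + v') + (α' - v') := by rw [e1, e2]
      have e4 : (α' + v') + (α' - v') = α' + α' := by abel
      rwa [es, e4] at h0
    have hd : v + v = v' + v' := by
      have h0 : (α + v) - (α - v) = (α' + v') - (α' - v') := by rw [e1, e2]
      have e4 : (α' + v') - (α' - v') = v' + v' := by abel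
      rwa [ed, e4] at h0
    exact Or.inl ⟨Or.inl (eq_of_two_eq hG hd), Or.inl (eq_of_two_eq hG hs)⟩
  · have hs : α + α = v' + v' := by
      have h0 : (α + v) + (α - v) = (α' + v') + -(α' - v') := by rw [e1, e2]
      have e4 : (α' + v') + -(α' - v') = v' + v' := by abel
      rwa [es, e4] at h0
    have hd : v + v = α' + α' := by
      have h0 : (α + v) - (α - v) = (α' + v') - -(α' - v') := by rw [e1, e2]
      have e4 : (α' + v') - -(α' - v') = α' + α' := by abel
      rwa [ed, e4] at h0
    exact Or.inr ⟨Or.inl (eq_of_two_eq hG hd), Or.inl (eq_of_two_eq hG hs).symm⟩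
  · have hs : α + α = -v' + -v' := by
      have h0 : (α + v) + (α - v) = -(α' + v') + (α' - v') := by rw [e1, e2]
      have e4 : -(α' + v') + (α' - v') = -v' + -v' := by abel
      rwa [es, e4] at h0
    have hd : v + v = -α' + -α' := by
      have h0 : (α + v) - (α - v) = -(α' + v') - (α' - v') := by rw [e1, e2]
      have e4 : -(α' + v') - (α' - v') = -α' + -α' := by abel
      rwa [ed, e4] at h0
    refine Or.inr ⟨Or.inr (eq_of_two_eq hG hd), Or.inr ?_⟩
    rw [eq_of_two_eq hG hs, neg_neg]
  · have hs : α + α = -α' + -α' := by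
      have h0 : (α + v) + (α - v) = -(α' + v') + -(α' - v') := by rw [e1, e2]
      have e4 : -(α' + v') + -(α' - v') = -α' + -α' := by abel
      rwa [es, e4] at h0
    have hd : v + v = -v' + -v' := by
      have h0 : (α + v) - (α - v) = -(α' + v') - -(α' - v') := by rw [e1, e2]
      have e4 : -(α' + v') - -(α' - v') = -v' + -v' := by abel
      rwa [ed, e4] at h0
    exact Or.inl ⟨Or.inr (eq_of_two_eq hG hd), Or.inr (eq_of_two_eq hG hs)⟩

/-- Crossed form: `α + v ~ α' - v'` and `α - v ~ α' + v'` force the same dichotomy. [this work, §8.8 (T6)] -/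
theorem signEq_pair_of_signEq_add_sub' (hG : ∀ x : G, x = -x → x = 0) {α α' v v' : G}
    (h₁ : SignEq (α + v) (α' - v')) (h₂ : SignEq (α - v) (α' + v')) :
    (SignEq v v' ∧ SignEq α α') ∨ (SignEq v α' ∧ SignEq v' α) := by
  have h₁' : SignEq (α + v) (α' + -v') := by rw [← sub_eq_add_neg]; exact h₁
  have h₂' : SignEq (α - v) (α' - -v') := by rw [sub_neg_eq_add]; exact h₂
  rcases signEq_pair_of_signEq_add_sub hG h₁' h₂' with ⟨hv, hα⟩ | ⟨hv, hv'⟩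
  · exact Or.inl ⟨hv.trans (Or.inr rfl), hα⟩
  · exact Or.inr ⟨hv, (show SignEq v' (-v') from Or.inr (neg_neg v').symm).trans hv'⟩

/-- **The general pin lemma.** If `w₁ ≁ w₂` are both admissible against `(α, v)` and both against `(α', v')`,
then `(v ~ v' ∧ α ~ α') ∨ (v ~ α' ∧ v' ~ α)` (no 2-torsion). [this work, §8.8 (T6)(d2)] -/
theorem signEq_pair_of_adm_adm (hG : ∀ x : G, x = -x → x = 0) {α α' v v' w₁ w₂ : G}
    (h₁ : Adm α v w₁) (h₂ : Adm α v w₂) (h₁' : Adm α' v' w₁) (h₂' : Adm α' v' w₂) (hw : ¬ SignEq w₁ w₂) :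
    (SignEq v v' ∧ SignEq α α') ∨ (SignEq v α' ∧ SignEq v' α) := by
  rcases h₁.signEq_add_or_sub with a₁ | a₁ <;> rcases h₂.signEq_add_or_sub with a₂ | a₂
  · exact absurd (a₁.trans a₂.symm) hw
  · rcases h₁'.signEq_add_or_sub with b₁ | b₁ <;> rcases h₂'.signEq_add_or_sub with b₂ | b₂
    · exact absurd (b₁.trans b₂.symm) hw
    · exact signEq_pair_of_signEq_add_sub hG (a₁.symm.trans b₁) (a₂.symm.trans b₂)
    · exact signEq_pair_of_signEq_add_sub' hG (a₁.symm.trans b₁) (a₂.symm.trans b₂)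
    · exact absurd (b₁.trans b₂.symm) hw
  · rcases h₁'.signEq_add_or_sub with b₁ | b₁ <;> rcases h₂'.signEq_add_or_sub with b₂ | b₂
    · exact absurd (b₁.trans b₂.symm) hw
    · exact signEq_pair_of_signEq_add_sub' hG (a₂.symm.trans b₂) (a₁.symm.trans b₁)
    · exact signEq_pair_of_signEq_add_sub hG (a₂.symm.trans b₂) (a₁.symm.trans b₁)
    · exact absurd (b₁.trans b₂.symm) hw
  · exact absurd (a₁.trans a₂.symm) hw

/-- Pin on a column pair of a rectangle: columns `j, j' ∈ J'` of `a` class-constant (classes `αc j`, `αc j'`)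
on `I'`, and a `k` whose `c`-row takes two inequivalent values on `I'`. [this work, §8.8 (T6)(d3)] -/
theorem Data.pin_of_colConst (hG : ∀ x : G, x = -x → x = 0) (D : Data ι G) {I' J' : Finset ι}
    {αc : ι → G} (ha : ∀ j ∈ J', ∀ i ∈ I', SignEq (D.a i j) (αc j)) {k i₁ i₂ : ι} (hi₁ : i₁ ∈ I')
    (hi₂ : i₂ ∈ I') (hw : ¬ SignEq (D.c k i₁) (D.c k i₂)) {j j' : ι} (hj : j ∈ J') (hj' : j' ∈ J') :
    (SignEq (D.b j k) (D.b j' k) ∧ SignEq (αc j) (αc j')) ∨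
      (SignEq (D.b j k) (αc j') ∧ SignEq (D.b j' k) (αc j)) :=
  signEq_pair_of_adm_adm hG
    ((D.adm_eqn i₁ j k).of_signEq_left (ha j hj i₁ hi₁))
    ((D.adm_eqn i₂ j k).of_signEq_left (ha j hj i₂ hi₂))
    ((D.adm_eqn i₁ j' k).of_signEq_left (ha j' hj' i₁ hi₁))
    ((D.adm_eqn i₂ j' k).of_signEq_left (ha j' hj' i₂ hi₂)) hw

/-- Within a class of columns the rows of `b` agree (at every `k` whose `c`-row is non-constant on `I'`). -/
theorem Data.b_agree_of_colConst (hG : ∀ x : G, x = -x → x = 0) (D : Data ι G) {I' J' : Finset ι}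
    {αc : ι → G} (ha : ∀ j ∈ J', ∀ i ∈ I', SignEq (D.a i j) (αc j)) {k i₁ i₂ : ι} (hi₁ : i₁ ∈ I')
    (hi₂ : i₂ ∈ I') (hw : ¬ SignEq (D.c k i₁) (D.c k i₂)) {j j' : ι} (hj : j ∈ J') (hj' : j' ∈ J')
    (hα : SignEq (αc j) (αc j')) : SignEq (D.b j' k) (D.b j k) := by
  rcases D.pin_of_colConst hG ha hi₁ hi₂ hw hj hj' with ⟨hb, _⟩ | ⟨hb, hb'⟩
  · exact hb.symm
  · exact hb'.trans (hα.trans hb.symm)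

/-- Two columns whose classes are both inequivalent to `αc j₁` have equivalent classes. -/
theorem Data.colClass_of_ne (hG : ∀ x : G, x = -x → x = 0) (D : Data ι G) {I' J' : Finset ι}
    {αc : ι → G} (ha : ∀ j ∈ J', ∀ i ∈ I', SignEq (D.a i j) (αc j)) {k i₁ i₂ : ι} (hi₁ : i₁ ∈ I')
    (hi₂ : i₂ ∈ I') (hw : ¬ SignEq (D.c k i₁) (D.c k i₂)) {j j' j₁ : ι} (hj : j ∈ J') (hj' : j' ∈ J')
    (hj₁ : j₁ ∈ J') (h1 : ¬ SignEq (αc j) (αc j₁)) (h2 : ¬ SignEq (αc j') (αc j₁)) :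
    SignEq (αc j) (αc j') := by
  rcases D.pin_of_colConst hG ha hi₁ hi₂ hw hj hj₁ with ⟨_, hα⟩ | ⟨_, hb₁⟩
  · exact absurd hα h1
  · rcases D.pin_of_colConst hG ha hi₁ hi₂ hw hj' hj₁ with ⟨_, hα'⟩ | ⟨_, hb₁'⟩
    · exact absurd hα' h2
    · exact hb₁.symm.trans hb₁'

variable {G₀ R : Type*} [AddCommGroup G₀]

/-- **THEOREM 8.15 (rectangle, every chart).** If `S¹` has no 2-torsion and the columns `j ∈ J'` of `a` are
class-constant on a common row set `I'` (classes `αc j`), then `n² · min(|I'|, |J'|/2) ≤ 2 · (r · |S⁰|)`.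
[this work, §8.8 (T6)(d3)] -/
theorem Data.sq_mul_min_le_of_rect [Fintype ι] [DecidableEq ι] [Fintype G₀] [DecidableEq G₀]
    [Fintype R] [DecidableEq R] (hG : ∀ x : G, x = -x → x = 0) (D : Data ι G) (Φ : Chart ι G₀)
    (κ : G → R) (hκ : ∀ x y, κ x = κ y → SignEq x y) (hsep : D.SepAll Φ) (I' J' : Finset ι)
    (αc : ι → G) (ha : ∀ j ∈ J', ∀ i ∈ I', SignEq (D.a i j) (αc j)) :
    Fintype.card ι ^ 2 * min I'.card (J'.card / 2) ≤ 2 * (Fintype.card R * Fintype.card G₀) := by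
  classical
  set Kc : Finset ι := Finset.univ.filter fun k => ∀ i ∈ I', ∀ i'' ∈ I', SignEq (D.c k i) (D.c k i'')
    with hKc
  set Knc : Finset ι := Finset.univ.filter fun k => ¬ ∀ i ∈ I', ∀ i'' ∈ I', SignEq (D.c k i) (D.c k i'')
    with hKnc
  have h2 := D.card_mul_le_of_c_rowsOn₂ Φ κ hκ hsep I' Kc (fun k hk => (Finset.mem_filter.mp hk).2)
  have hwit : ∀ k ∈ Knc, ∃ i₁ ∈ I', ∃ i₂ ∈ I', ¬ SignEq (D.c k i₁) (D.c k i₂) := by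
    intro k hk
    have h := (Finset.mem_filter.mp hk).2
    push Not at h
    exact h
  -- a half of `J'` whose rows of `b` agree on the columns `k ∈ Knc`
  obtain ⟨J₀, hJ₀card, hJ₀agree⟩ : ∃ J₀ : Finset ι, J'.card ≤ 2 * J₀.card ∧
      ∀ j ∈ J₀, ∀ j' ∈ J₀, ∀ k ∈ Knc, SignEq (D.b j' k) (D.b j k) := by
    rcases Knc.eq_empty_or_nonempty with hK | ⟨k₀, hk₀⟩
    · exact ⟨J', by omega, by simp [hK]⟩
    rcases J'.eq_empty_or_nonempty with hJ | ⟨j₁, hj₁⟩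
    · exact ⟨J', by simp [hJ], by simp [hJ]⟩
    obtain ⟨i₁, hi₁, i₂, hi₂, hw⟩ := hwit k₀ hk₀
    have agree : ∀ J₀, J₀ ⊆ J' → (∀ j ∈ J₀, ∀ j' ∈ J₀, SignEq (αc j) (αc j')) →
        ∀ j ∈ J₀, ∀ j' ∈ J₀, ∀ k ∈ Knc, SignEq (D.b j' k) (D.b j k) := by
      intro J₀ hsub hcl j hj j' hj' k hk
      obtain ⟨i₃, hi₃, i₄, hi₄, hw'⟩ := hwit k hk
      exact D.b_agree_of_colConst hG ha hi₃ hi₄ hw' (hsub hj) (hsub hj') (hcl j hj j' hj')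
    set JA : Finset ι := J'.filter fun j => SignEq (αc j) (αc j₁) with hJA
    set JB : Finset ι := J'.filter fun j => ¬ SignEq (αc j) (αc j₁) with hJB
    have hcardAB : JA.card + JB.card = J'.card := by
      rw [hJA, hJB]
      exact Finset.card_filter_add_card_filter_not _
    have hA : ∀ j ∈ JA, ∀ j' ∈ JA, SignEq (αc j) (αc j') := fun j hj j' hj' =>
      (Finset.mem_filter.mp hj).2.trans (Finset.mem_filter.mp hj').2.symm
    have hB : ∀ j ∈ JB, ∀ j' ∈ JB, SignEq (αc j) (αc j') := fun j hj j' hj' =>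
      D.colClass_of_ne hG ha hi₁ hi₂ hw (Finset.mem_filter.mp hj).1 (Finset.mem_filter.mp hj').1 hj₁
        (Finset.mem_filter.mp hj).2 (Finset.mem_filter.mp hj').2
    by_cases hle : JB.card ≤ JA.card
    · exact ⟨JA, by omega, agree JA (Finset.filter_subset _ _) hA⟩
    · exact ⟨JB, by omega, agree JB (Finset.filter_subset _ _) hB⟩
  have h1 := D.card_mul_le_of_b_rowsOn₂ Φ κ hκ hsep J₀ Knc hJ₀agree
  have hK : Kc.card + Knc.card = Fintype.card ι := by
    rw [hKc, hKnc, Finset.card_filter_add_card_filter_not, Finset.card_univ]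
  have hmI : min I'.card (J'.card / 2) ≤ I'.card := min_le_left _ _
  have hmJ : min I'.card (J'.card / 2) ≤ J₀.card := by
    have h := min_le_right I'.card (J'.card / 2)
    omega
  set n := Fintype.card ι
  set M := Fintype.card R * Fintype.card G₀
  set m := min I'.card (J'.card / 2)
  calc n ^ 2 * m = n * (Kc.card + Knc.card) * m := by rw [hK]; ring
    _ = n * Kc.card * m + n * Knc.card * m := by ring
    _ ≤ n * Kc.card * I'.card + n * Knc.card * J₀.card :=
        Nat.add_le_add (Nat.mul_le_mul_left _ hmI) (Nat.mul_le_mul_left _ hmJ)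
    _ ≤ M + M := Nat.add_le_add h2 h1
    _ = 2 * M := by ring

/-- COROLLARY (all columns class-constant on a row set `I'` of size `μ`): `n² · min(μ, n/2) ≤ 2 · (r · |S⁰|)`. -/
theorem Data.sq_mul_min_le_of_rows [Fintype ι] [DecidableEq ι] [Fintype G₀] [DecidableEq G₀]
    [Fintype R] [DecidableEq R] (hG : ∀ x : G, x = -x → x = 0) (D : Data ι G) (Φ : Chart ι G₀)
    (κ : G → R) (hκ : ∀ x y, κ x = κ y → SignEq x y) (hsep : D.SepAll Φ) (I' : Finset ι)
    (αc : ι → G) (ha : ∀ j, ∀ i ∈ I', SignEq (D.a i j) (αc j)) :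
    Fintype.card ι ^ 2 * min I'.card (Fintype.card ι / 2) ≤ 2 * (Fintype.card R * Fintype.card G₀) := by
  have h := D.sq_mul_min_le_of_rect hG Φ κ hκ hsep I' Finset.univ αc (fun j _ i hi => ha j i hi)
  rwa [Finset.card_univ] at h

end FibreLines

end Summit.MatrixMultiplication.MatrixMultiplication.Theorems.TwistedTPP
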